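import Literature.NumberTheory.Sieve.SieveFramework
import HarnessLib

/-!
# Route `RoughParitySectors`, crux `OddSectorShareLinear` (stmt-Parity-15629), line `birth`:
# helpers IV for the stub `stub_sieveDecouplingPrime` — elementary inequalities of the assembly

`--supports stmt-Parity-15629`.  Real-variable bookkeeping for the final assembly of the stub S'a
(kept out of the stub file so that its elaboration stays small): the level condition
`α x^{1/5} ≤ y^{1/4}` and `log y ≥ (log x)/2` for `y = αx + β ≥ x/2`, the exponent identity
`log x^{1/5}/log x^{1/U} = U/5`, the transfer of the Bombieri–Vinogradov bound from `y` to `x`,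
the absorption of the error terms into `c₄ x/(log x)^{2S+1}`, the lower bound
`∏_{p<z}(1 − g p) ≥ (log 2)^n/(K (log x)^n)` from the dimension condition
(`SieveDecoupling.prod_one_sub_ge`), and the final three-line combination (`SieveDecoupling.final_step`).
-/

noncomputable section

open Finset
open scoped BigOperators
open Literature.NumberTheory.Sieve

namespace Summit.Parity.BatemanHorn.Cruxes.OddSectorShareLinear.Birth

namespace SieveDecoupling

/-- `√x ≤ x/2` and `x/2 ≤ αx + β` once `x ≥ 4`, `α ≥ 1` and `|β| + 2 ≤ z' ≤ √x`. [folklore] -/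
theorem half_le_linear {x α β z' : ℝ} (hx : 4 ≤ x) (hα : 1 ≤ α) (hβ : |β| + 2 ≤ z')
    (hz : z' ≤ x ^ (1 / 2 : ℝ)) : x ^ (1 / 2 : ℝ) ≤ x / 2 ∧ x / 2 ≤ α * x + β := by
  have hx0 : 0 < x := by linarith
  have hsq : x ^ (1 / 2 : ℝ) * x ^ (1 / 2 : ℝ) = x := by rw [← Real.rpow_add hx0]; norm_num
  have h2 : 2 ≤ x ^ (1 / 2 : ℝ) := by linarith [abs_nonneg β]
  have hs : x ^ (1 / 2 : ℝ) ≤ x / 2 := by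
    rw [le_div_iff₀ (by norm_num : (0 : ℝ) < 2)]; nlinarith
  refine ⟨hs, ?_⟩
  have h3 : x ≤ α * x := le_mul_of_one_le_left hx0.le hα
  linarith [neg_abs_le β]

/-- `log y ≥ (log x)/2` for `y ≥ x/2`, `x ≥ 4`. [folklore] -/
theorem log_half_le {x y : ℝ} (hx : 4 ≤ x) (hy : x / 2 ≤ y) : Real.log x / 2 ≤ Real.log y := by
  have hx0 : 0 < x := by linarith
  have h4 : Real.log 4 = 2 * Real.log 2 := by
    rw [show (4 : ℝ) = 2 ^ 2 by norm_num, Real.log_pow]; norm_num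
  have hl2 : Real.log 2 ≤ Real.log x / 2 := by
    have := Real.log_le_log (by norm_num) hx; linarith
  have := Real.log_le_log (by linarith) hy
  rw [Real.log_div hx0.ne' two_ne_zero] at this
  linarith

/-- The level condition: `a x^{1/5} ≤ y^{1/4}` once `y ≥ x/2 > 0` and `x^{1/20} ≥ 2a`. [folklore] -/
theorem level_le {x y a : ℝ} (hx : 0 < x) (hy : x / 2 ≤ y)
    (h20 : 2 * a ≤ x ^ (1 / 20 : ℝ)) : a * x ^ (1 / 5 : ℝ) ≤ y ^ (1 / 4 : ℝ) := by
  have h14 : x ^ (1 / 4 : ℝ) = x ^ (1 / 5 : ℝ) * x ^ (1 / 20 : ℝ) := by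
    rw [← Real.rpow_add hx]; norm_num
  have h2 : (x / 2) ^ (1 / 4 : ℝ) ≤ y ^ (1 / 4 : ℝ) :=
    Real.rpow_le_rpow (by positivity) hy (by norm_num)
  have h3 : (x / 2) ^ (1 / 4 : ℝ) = x ^ (1 / 4 : ℝ) / 2 ^ (1 / 4 : ℝ) :=
    Real.div_rpow hx.le (by norm_num) _
  have h4 : (2 : ℝ) ^ (1 / 4 : ℝ) ≤ 2 := by
    calc (2 : ℝ) ^ (1 / 4 : ℝ) ≤ 2 ^ (1 : ℝ) :=
          Real.rpow_le_rpow_of_exponent_le (by norm_num) (by norm_num)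
      _ = 2 := Real.rpow_one 2
  have h5 : x ^ (1 / 4 : ℝ) / 2 ≤ x ^ (1 / 4 : ℝ) / 2 ^ (1 / 4 : ℝ) :=
    div_le_div_of_nonneg_left (by positivity) (by positivity) h4
  have h6 : a * x ^ (1 / 5 : ℝ) ≤ x ^ (1 / 4 : ℝ) / 2 := by
    rw [h14, le_div_iff₀ (by norm_num : (0 : ℝ) < 2)]
    have : 0 ≤ x ^ (1 / 5 : ℝ) := by positivity
    nlinarith
  linarith

/-- `log x^{1/5} / log x^{1/U} = U/5` for `x > 1`, `U ≠ 0`. [folklore] -/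
theorem log_rpow_div_log_rpow {x U : ℝ} (hx : 1 < x) (hU : U ≠ 0) :
    Real.log (x ^ (1 / 5 : ℝ)) / Real.log (x ^ (1 / U)) = U / 5 := by
  have hx0 : 0 < x := by linarith
  have hlog : Real.log x ≠ 0 := (Real.log_pos hx).ne'
  rw [Real.log_rpow hx0, Real.log_rpow hx0]
  field_simp

/-- `D² ⌈z'⌉ ≤ 2 √x` for `D = x^{1/5}`, `1 ≤ z' ≤ x^{1/10}`, `x > 0`. [folklore] -/
theorem sq_mul_ceil_le {x z' : ℝ} (hx : 0 < x) (hz1 : 1 ≤ z') (hz : z' ≤ x ^ (1 / 10 : ℝ)) :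
    x ^ (1 / 5 : ℝ) * x ^ (1 / 5 : ℝ) * ⌈z'⌉₊ ≤ 2 * x ^ (1 / 2 : ℝ) := by
  have hzc : (⌈z'⌉₊ : ℝ) ≤ 2 * z' := by
    have := (Nat.ceil_lt_add_one (by linarith : (0 : ℝ) ≤ z')).le; linarith
  have hDD : x ^ (1 / 5 : ℝ) * x ^ (1 / 5 : ℝ) = x ^ (2 / 5 : ℝ) := by
    rw [← Real.rpow_add hx]; norm_num
  have hprod : x ^ (2 / 5 : ℝ) * x ^ (1 / 10 : ℝ) = x ^ (1 / 2 : ℝ) := by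
    rw [← Real.rpow_add hx]; norm_num
  rw [hDD, ← hprod]
  have : 0 ≤ x ^ (2 / 5 : ℝ) := by positivity
  nlinarith

/-- Transfer of a bound `C y/(log y)^n` from `y ≤ (α+1) x` with `log y ≥ (log x)/2 > 0` to `x`:
`C y/(log y)^n ≤ max(C,1) (α+1) 2^n x/(log x)^n`. [folklore] -/
theorem bound_transfer {C x y α L : ℝ} {n : ℕ} (hL : 0 < L) (hlogy : L / 2 ≤ Real.log y)
    (hy0 : 0 ≤ y) (hyx : y ≤ (α + 1) * x) (hα : 0 ≤ α) :
    C * y / Real.log y ^ n ≤ max C 1 * (α + 1) * 2 ^ n * x / L ^ n := by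
  have hlogy0 : 0 < Real.log y := by linarith
  have hx0 : 0 ≤ x := by nlinarith
  have hL2 : (L / 2) ^ n ≤ Real.log y ^ n := pow_le_pow_left₀ (by positivity) hlogy _
  calc C * y / Real.log y ^ n ≤ max C 1 * y / Real.log y ^ n := by
        rw [mul_div_assoc, mul_div_assoc]
        exact mul_le_mul_of_nonneg_right (le_max_left _ _) (by positivity)
    _ ≤ max C 1 * ((α + 1) * x) / (L / 2) ^ n :=
        div_le_div₀ (by positivity) (mul_le_mul_of_nonneg_left hyx (by positivity)) (by positivity) hL2
    _ = max C 1 * (α + 1) * 2 ^ n * x / L ^ n := by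
        rw [div_pow]; field_simp

/-- **Absorption of the error terms.**  With `L = log x ≥ max(1, 2(η/4+2)C₃/c₄)`,
`(n₀ + √x) L^m ≤ (c₄/(4(η/4+2))) x` and `B ≤ C₃ x/L^{m+2}`:
`(n₀ + (η/4+2)(B + 2√x)) L^m ≤ c₄ x`. [folklore] -/
theorem junk_le {n₀ s L B C₃ c₄ η x : ℝ} {m : ℕ} (hη : 0 < η) (hc₄ : 0 < c₄)
    (hx : 0 < x) (hn₀ : 0 ≤ n₀) (hL1 : 1 ≤ L) (hLbig : 2 * (η / 4 + 2) * C₃ / c₄ ≤ L)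
    (habs : (n₀ + s) * L ^ m ≤ c₄ / (4 * (η / 4 + 2)) * x) (hB : B ≤ C₃ * x / L ^ (m + 2)) :
    (n₀ + (η / 4 + 2) * (B + 2 * s)) * L ^ m ≤ c₄ * x := by
  have hL0 : 0 < L := by linarith
  have hB1 : B * L ^ m ≤ C₃ * x / L ^ 2 := by
    have := mul_le_mul_of_nonneg_right hB (pow_nonneg hL0.le m)
    refine this.trans (le_of_eq ?_)
    rw [pow_add]
    field_simp
  have hB2 : C₃ * x / L ^ 2 ≤ c₄ * x / (2 * (η / 4 + 2)) := by
    rw [div_le_div_iff₀ (by positivity) (by positivity)]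
    have h1 : C₃ * (2 * (η / 4 + 2)) ≤ c₄ * L := by
      have := (div_le_iff₀ hc₄).mp hLbig; linarith
    have h2 : c₄ * L ≤ c₄ * L ^ 2 := by
      rw [sq]; exact mul_le_mul_of_nonneg_left (le_mul_of_one_le_left hL0.le hL1) hc₄.le
    nlinarith
  have hBB : (η / 4 + 2) * (B * L ^ m) ≤ c₄ * x / 2 := by
    have := mul_le_mul_of_nonneg_left (hB1.trans hB2) (by positivity : (0 : ℝ) ≤ η / 4 + 2)
    refine this.trans (le_of_eq ?_)
    field_simp
  have hA : (n₀ + (η / 4 + 2) * (2 * s)) * L ^ m ≤ c₄ * x / 2 := by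
    have h1 : n₀ + (η / 4 + 2) * (2 * s) ≤ 2 * (η / 4 + 2) * (n₀ + s) := by nlinarith
    calc (n₀ + (η / 4 + 2) * (2 * s)) * L ^ m ≤ 2 * (η / 4 + 2) * (n₀ + s) * L ^ m :=
          mul_le_mul_of_nonneg_right h1 (pow_nonneg hL0.le _)
      _ = 2 * (η / 4 + 2) * ((n₀ + s) * L ^ m) := by ring
      _ ≤ 2 * (η / 4 + 2) * (c₄ / (4 * (η / 4 + 2)) * x) :=
          mul_le_mul_of_nonneg_left habs (by positivity)
      _ = c₄ * x / 2 := by field_simp; ring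
  have e : (n₀ + (η / 4 + 2) * (B + 2 * s)) * L ^ m =
      (η / 4 + 2) * (B * L ^ m) + (n₀ + (η / 4 + 2) * (2 * s)) * L ^ m := by ring
  rw [e]
  linarith

/-- **The main term dominates**: `c₄ x/L^{2S+1} ≤ (3η/4) W Q` from `W ≥ w₀/L^{2S}`,
`Q ≥ (c_Q/2) x/L` and `c₄ = (3η/4) w₀ (c_Q/2)`. [folklore] -/
theorem main_term_ge {W Q w₀ cQ η x L : ℝ} {S : ℕ} (hη : 0 < η) (hw₀ : 0 < w₀) (hcQ : 0 < cQ)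
    (hx : 0 < x) (hL : 0 < L) (hW : w₀ / L ^ (2 * S) ≤ W) (hQ : cQ / 2 * x / L ≤ Q) (hW0 : 0 ≤ W) :
    3 * η / 4 * (w₀ * (cQ / 2)) * x / L ^ (2 * S + 1) ≤ 3 * η / 4 * (W * Q) := by
  have h1 : w₀ / L ^ (2 * S) * (cQ / 2 * x / L) ≤ W * Q :=
    mul_le_mul hW hQ (by positivity) hW0
  calc 3 * η / 4 * (w₀ * (cQ / 2)) * x / L ^ (2 * S + 1)
      = 3 * η / 4 * (w₀ / L ^ (2 * S) * (cQ / 2 * x / L)) := by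
        rw [pow_succ]; field_simp
    _ ≤ 3 * η / 4 * (W * Q) := mul_le_mul_of_nonneg_left h1 (by positivity)

/-- **Lower bound for the sieve product from the dimension condition**: if `g` has dimension `n`
with constant `K` then `∏_{p < ⌈z'⌉} (1 − g(p)) ≥ (log 2)^n/K/(log x)^n` for `2 ≤ z' ≤ x`
(the condition with `w = 2`, `log z' ≤ log x`). [folklore] -/
theorem prod_one_sub_ge {g : ArithmeticFunction ℝ} {K : ℝ} {n : ℕ}
    (hdim : HasSieveDimension g (n : ℝ) K) {z' x : ℝ} (hz' : 2 ≤ z') (hz'x : z' ≤ x) :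
    Real.log 2 ^ n / K / Real.log x ^ n ≤ ∏ p ∈ Nat.primesBelow ⌈z'⌉₊, (1 - g p) := by
  have hK1 : 1 ≤ K := hdim.one_le
  have hlog2 : 0 < Real.log 2 := Real.log_pos one_lt_two
  have h2 := hdim.2 2 z' le_rfl hz'
  have hfilter : (Nat.primesBelow ⌈z'⌉₊).filter (fun p : ℕ => (2 : ℝ) ≤ (p : ℝ)) =
      Nat.primesBelow ⌈z'⌉₊ :=
    filter_true_of_mem fun p hp => by exact_mod_cast (Nat.prime_of_mem_primesBelow hp).two_le
  rw [hfilter, prod_inv_distrib, Real.rpow_natCast] at h2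
  have hWpos : 0 < ∏ p ∈ Nat.primesBelow ⌈z'⌉₊, (1 - g p) :=
    prod_pos fun p hp => sub_pos.mpr (hdim.1 p (Nat.prime_of_mem_primesBelow hp)).2
  have hlz : Real.log z' ≤ Real.log x := Real.log_le_log (by linarith) hz'x
  have hlz0 : 0 < Real.log z' := Real.log_pos (by linarith)
  have h3 : (∏ p ∈ Nat.primesBelow ⌈z'⌉₊, (1 - g p))⁻¹ ≤ K * (Real.log x / Real.log 2) ^ n :=
    h2.trans (mul_le_mul_of_nonneg_left (pow_le_pow_left₀ (by positivity)
      (div_le_div_of_nonneg_right hlz hlog2.le) _) (by linarith))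
  have h4 := inv_anti₀ (inv_pos.mpr hWpos) h3
  rw [inv_inv] at h4
  refine le_trans (le_of_eq ?_) h4
  have hlogx : 0 < Real.log x := lt_of_lt_of_le hlz0 hlz
  rw [div_pow]
  field_simp

/-- `∏_{p < ⌈z'⌉} (1 − g(p)) ≤ 1` under the dimension condition (`0 ≤ g(p) < 1`). [folklore] -/
theorem prod_one_sub_le_one {g : ArithmeticFunction ℝ} {κ K : ℝ} (hdim : HasSieveDimension g κ K)
    (z' : ℝ) : ∏ p ∈ Nat.primesBelow ⌈z'⌉₊, (1 - g p) ≤ 1 :=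
  prod_le_one (fun p hp => (sub_pos.mpr (hdim.1 p (Nat.prime_of_mem_primesBelow hp)).2).le)
    fun p hp => sub_le_self _ (hdim.1 p (Nat.prime_of_mem_primesBelow hp)).1

/-- **The final combination.**  From the sieve inequality
`|P − WQ| ≤ n₀ + C₀ e W (Q + E₁) + R + W E₁` with `C₀ e ≤ η/4`, `0 ≤ W ≤ 1`, `Q, E₁ ≥ 0`,
`E₁, R ≤ T` and `n₀ + (η/4 + 2) T ≤ (3η/4) W Q`: `|P − WQ| ≤ η W Q`. [folklore] -/
theorem final_step {P Q W E₁ R T n₀ C₀ e η : ℝ} (hη : 0 < η)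
    (hmain : |P - W * Q| ≤ n₀ + C₀ * e * W * (Q + E₁) + R + W * E₁)
    (heU : C₀ * e ≤ η / 4) (hW0 : 0 ≤ W) (hW1 : W ≤ 1) (hQ0 : 0 ≤ Q) (hE0 : 0 ≤ E₁)
    (hET : E₁ ≤ T) (hRT : R ≤ T) (hjunk : n₀ + (η / 4 + 2) * T ≤ 3 * η / 4 * (W * Q)) :
    |P - W * Q| ≤ η * (W * Q) := by
  have h1 : C₀ * e * W * (Q + E₁) ≤ η / 4 * (W * Q) + η / 4 * T := by
    have ha : C₀ * e * W * (Q + E₁) ≤ η / 4 * W * (Q + E₁) :=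
      mul_le_mul_of_nonneg_right (mul_le_mul_of_nonneg_right heU hW0) (by linarith)
    have hb : η / 4 * W * E₁ ≤ η / 4 * T := by
      calc η / 4 * W * E₁ ≤ η / 4 * 1 * E₁ :=
            mul_le_mul_of_nonneg_right (mul_le_mul_of_nonneg_left hW1 (by positivity)) hE0
        _ ≤ η / 4 * T := by rw [mul_one]; exact mul_le_mul_of_nonneg_left hET (by positivity)
    nlinarith
  have h2 : W * E₁ ≤ T := (mul_le_of_le_one_left hE0 hW1).trans hET
  linarith

end SieveDecoupling

/-- **Sub-goal (lower bound for the sieve product from the dimension condition)** of the stub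
`stub_sieveDecouplingPrime` (crux stmt-Parity-15629, line `birth`): a density of sieve dimension `n`
with constant `K` has `∏_{p<⌈z'⌉}(1 − g p) ≥ (log 2)^n/K/(log x)^n` for `2 ≤ z' ≤ x`
(`SieveDecoupling.prod_one_sub_ge`). [folklore] -/
theorem stub_decouplingProductLower :
    ∀ (g : ArithmeticFunction ℝ) (K : ℝ) (n : ℕ), Literature.NumberTheory.Sieve.HasSieveDimension g
    (n : ℝ) K → ∀ (z' x : ℝ), 2 ≤ z' → z' ≤ x → Real.log 2 ^ n / K / Real.log x ^ n ≤ ∏ p ∈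
    Nat.primesBelow ⌈z'⌉₊, (1 - g p) :=
  fun _ _ _ hdim _ _ hz' hz'x => SieveDecoupling.prod_one_sub_ge hdim hz' hz'x

end Summit.Parity.BatemanHorn.Cruxes.OddSectorShareLinear.Birth

end
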